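import Summits.Ventures.DiscreteObjects.PP12.OrderElevenTriangle
import Summits.Ventures.DiscreteObjects.PP12.OrderElevenCollineation

/-!
# PP(12), order-11 cell, Case A (homology): the plane ⇒ `QdmRows 11 13` array reduction in the kernel
Framing: lottery ticket; floor = certified bounds/negative ranges.

Cell pub-namedobj (venture DiscreteObjects), target (M), designs gen 16. `OrderElevenCollineation` TYPES the Case-A normal form of a
projective plane of order 12 with a HOMOLOGY `σ` of order 11 (axis `l`, centre `c ∉ l`): a `13 × 13` array `d` over `ZMod 11` with
`QdmRows 11 13 d` (FAMILY-B1P §2), and the census statement `NoHomologyArray12` (decided EMPTY outside the kernel: designs E1 `caseA.c` =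
`caseA.py`, 104,622,730 nodes, farm twin j097463; in print Janko–van Trung 1982). The step "homology ⇒ array" was a paper proof. Here it is
a kernel theorem:

* `linePts h12 m : Fin 13 ≃ {p // p ∈ m}` (points of a line of a plane of order 12);
* the frame of FAMILY-B1P §2: `X_j` (`j : Fin 13`) the points of the axis, the fixed lines `c X_j` (`cx11`), base points `P_j ∈ c X_j`
  (`bp11`, `≠ c, X_j`), base lines `L_i ∋ X_i` (`bl11`, `≠ l`, `c ∉ L_i`); a homology `≠ 1` and its powers `σ^k`, `11 ∤ k`, move every
  point off `l ∪ {c}` (`pow_apply_ne_of_off_axis`), so `x ↦ σ^x P_j` (`x < 11`) is a bijection onto the points of `c X_j` other than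
  `c, X_j` and **`L_i` meets `c X_j` in `σ^{d i j} P_j`** for an exponent `d i j` (`dexp11`, `pow_dexp11_mem`);
* **`qdmRows_homArray11 : QdmRows 11 13 (σ.homArray11 …)`**: equal differences `d i j − d i' j = d i j' − d i' j'` would put the two
  points `σ^{d i j + d i' j'} P_j ∈ c X_j` and `σ^{d i j' + d i' j'} P_{j'} ∈ c X_{j'}` on both lines `σ^{d i' j'} L_i ≠ σ^{d i j'} L_{i'}`,
  forcing them to coincide with `c`;
* **`no_homology11_of_noHomologyArray12`**: under `NoHomologyArray12` a projective plane of order 12 has no homology of order 11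
  (Case A of `PrimeOrderStructure.order12_q11_axis_or_two` is dead). Case B (triangle) is the companion file.

Nothing here asserts any census statement. No `sorry`, no new axioms.
-/

namespace Summit.Ventures.DiscreteObjects.PP12

open Configuration Finset
open scoped Classical

section Frame

variable {P L : Type*} [Membership P L] [ProjectivePlane P L] [Fintype P] [Fintype L]

/-- a line of a plane of order 12 has 13 points (subtype form) -/
theorem card_subtype_mem_line (h12 : ProjectivePlane.order P L = 12) (m : L) : Fintype.card {p : P // p ∈ m} = 13 := by
  rw [Fintype.card_subtype, Collineation.card_points_on_line (P := P) m, h12]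

/-- **`Fin 13 ≃` the points of a line** (order 12). -/
noncomputable def linePts (h12 : ProjectivePlane.order P L = 12) (m : L) : Fin 13 ≃ {p : P // p ∈ m} :=
  (Fintype.equivFinOfCardEq (card_subtype_mem_line h12 m)).symm

end Frame


namespace Collineation

variable {P L : Type*} [Membership P L] (σ : Collineation P L) [ProjectivePlane P L] [Fintype P] [Fintype L]

section ElevenA

variable (h12 : ProjectivePlane.order P L = 12) (hne : σ.onPoints ≠ 1) (hq : σ.onPoints ^ 11 = 1)
  {l : L} {c : P} (hl : σ.IsAxis l) (hc : σ.IsCenter c) (hcl : c ∉ l)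

include hne hq hl hc in
/-- **A homology `≠ 1` of order 11 and its powers `σ^k`, `11 ∤ k`, move every point off `l ∪ {c}`.** -/
theorem pow_apply_ne_of_off_axis {k : ℕ} (hk : ¬ 11 ∣ k) {r : P} (hr : r ∉ l) (hrc : r ≠ c) : (σ.onPoints ^ k) r ≠ r := by
  intro hfix
  have hne' : (σ.power k).onPoints ≠ 1 := pow_ne_one_of_prime_not_dvd σ.onPoints (by norm_num) hq hne hk
  apply hne'
  ext s
  exact (σ.power k).eq_self_of_central_of_fixed (σ.power_isAxis hl k) (σ.power_isCenter hc k) hr hrc hfix s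

/-! ### The frame: axis points `X_j`, fixed lines `c X_j`, base points `P_j`, base lines `L_i` -/

/-- **`X_j`**: the points of the axis. -/
noncomputable def axPt11 (l : L) (j : Fin 13) : P := (linePts h12 l j).1
omit σ in
/-- `X_j ∈ l` -/
theorem axPt11_mem (j : Fin 13) : axPt11 h12 l j ∈ l := (linePts h12 l j).2
omit σ in
/-- `j ↦ X_j` is injective -/
theorem axPt11_injective : Function.Injective (axPt11 (P := P) h12 l) := fun _ _ h => (linePts h12 l).injective (Subtype.ext h)
omit σ in
include hcl in
/-- `c ≠ X_j` -/
theorem c_ne_axPt11 (j : Fin 13) : c ≠ axPt11 h12 l j := fun h => hcl (h ▸ axPt11_mem h12 j)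

/-- **`c X_j`**: the line joining the centre to `X_j` (a fixed line). -/
noncomputable def cx11 (j : Fin 13) : L := HasLines.mkLine (c_ne_axPt11 h12 hcl j)
omit σ in
/-- `c ∈ c X_j` -/
theorem c_mem_cx11 (j : Fin 13) : c ∈ cx11 h12 hcl j := (HasLines.mkLine_ax (c_ne_axPt11 h12 hcl j)).1
omit σ in
/-- `X_j ∈ c X_j` -/
theorem axPt11_mem_cx11 (j : Fin 13) : axPt11 h12 l j ∈ cx11 h12 hcl j := (HasLines.mkLine_ax (c_ne_axPt11 h12 hcl j)).2
omit σ in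
/-- `c X_j ≠ l` -/
theorem cx11_ne_axis (j : Fin 13) : cx11 h12 hcl j ≠ l := fun h => hcl (h ▸ c_mem_cx11 h12 hcl j)
omit σ in
/-- `c X_j ∩ l = {X_j}` -/
theorem eq_axPt11_of_mem_cx11_of_mem_axis (j : Fin 13) {p : P} (h1 : p ∈ cx11 h12 hcl j) (h2 : p ∈ l) : p = axPt11 h12 l j :=
  (Nondegenerate.eq_or_eq h1 (axPt11_mem_cx11 h12 hcl j) h2 (axPt11_mem h12 j)).resolve_right (cx11_ne_axis h12 hcl j)
omit σ in
/-- `j ↦ c X_j` is injective -/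
theorem cx11_injective : Function.Injective (cx11 (P := P) h12 hcl) := fun j j' h =>
  axPt11_injective h12 (eq_axPt11_of_mem_cx11_of_mem_axis h12 hcl j' (h ▸ axPt11_mem_cx11 h12 hcl j) (axPt11_mem h12 j))
omit σ in
/-- `c X_j ∩ c X_{j'} = {c}` for `j ≠ j'` -/
theorem eq_c_of_mem_cx11_of_mem_cx11 {j j' : Fin 13} (hjj' : j ≠ j') {p : P} (h1 : p ∈ cx11 h12 hcl j) (h2 : p ∈ cx11 h12 hcl j') :
    p = c :=
  (Nondegenerate.eq_or_eq h1 (c_mem_cx11 h12 hcl j) h2 (c_mem_cx11 h12 hcl j')).resolve_right fun h => hjj' (cx11_injective h12 hcl h)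

include hc in
/-- `c X_j` is a fixed line -/
theorem cx11_fixed (j : Fin 13) : σ.onLines (cx11 h12 hcl j) = cx11 h12 hcl j := hc _ (c_mem_cx11 h12 hcl j)

/-- **`P_j`**: a base point on `c X_j` other than `c` and `X_j`. -/
noncomputable def bp11 (j : Fin 13) : P := Classical.choose (exists_mem_ne_ne (cx11 h12 hcl j) c (axPt11 h12 l j))
omit σ in
/-- `P_j ∈ c X_j` -/
theorem bp11_mem_cx11 (j : Fin 13) : bp11 h12 hcl j ∈ cx11 h12 hcl j :=
  (Classical.choose_spec (exists_mem_ne_ne (cx11 h12 hcl j) c (axPt11 h12 l j))).1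
omit σ in
/-- `P_j ≠ c` -/
theorem bp11_ne_c (j : Fin 13) : bp11 h12 hcl j ≠ c := (Classical.choose_spec (exists_mem_ne_ne (cx11 h12 hcl j) c (axPt11 h12 l j))).2.1
omit σ in
/-- `P_j ≠ X_j` -/
theorem bp11_ne_axPt11 (j : Fin 13) : bp11 h12 hcl j ≠ axPt11 h12 l j :=
  (Classical.choose_spec (exists_mem_ne_ne (cx11 h12 hcl j) c (axPt11 h12 l j))).2.2
omit σ in
/-- `P_j ∉ l` -/
theorem bp11_not_mem_axis (j : Fin 13) : bp11 h12 hcl j ∉ l := fun h =>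
  bp11_ne_axPt11 h12 hcl j (eq_axPt11_of_mem_cx11_of_mem_axis h12 hcl j (bp11_mem_cx11 h12 hcl j) h)

/-- an auxiliary point off `l` and off `c X_i` (to span the base line `L_i`) -/
noncomputable def aux11 (i : Fin 13) : P := Classical.choose (exists_not_mem_not_mem (P := P) (cx11 h12 hcl i) l)
omit σ in
/-- the auxiliary point is off `c X_i` -/
theorem aux11_not_mem_cx11 (i : Fin 13) : aux11 h12 hcl i ∉ cx11 h12 hcl i :=
  (Classical.choose_spec (exists_not_mem_not_mem (P := P) (cx11 h12 hcl i) l)).1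
omit σ in
/-- the auxiliary point is off `l` -/
theorem aux11_not_mem_axis (i : Fin 13) : aux11 h12 hcl i ∉ l :=
  (Classical.choose_spec (exists_not_mem_not_mem (P := P) (cx11 h12 hcl i) l)).2
omit σ in
/-- the auxiliary point is not `X_i` -/
theorem aux11_ne_axPt11 (i : Fin 13) : aux11 h12 hcl i ≠ axPt11 h12 l i := fun h => aux11_not_mem_axis h12 hcl i (h ▸ axPt11_mem h12 i)

/-- **`L_i`**: a base line through `X_i`, `≠ l`, not through `c`. -/
noncomputable def bl11 (i : Fin 13) : L := HasLines.mkLine (aux11_ne_axPt11 h12 hcl i)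
omit σ in
/-- `X_i ∈ L_i` -/
theorem axPt11_mem_bl11 (i : Fin 13) : axPt11 h12 l i ∈ bl11 h12 hcl i := (HasLines.mkLine_ax (aux11_ne_axPt11 h12 hcl i)).2
omit σ in
/-- the auxiliary point is on `L_i` -/
theorem aux11_mem_bl11 (i : Fin 13) : aux11 h12 hcl i ∈ bl11 h12 hcl i := (HasLines.mkLine_ax (aux11_ne_axPt11 h12 hcl i)).1
omit σ in
/-- `L_i ≠ l` -/
theorem bl11_ne_axis (i : Fin 13) : bl11 h12 hcl i ≠ l := fun h =>
  aux11_not_mem_axis h12 hcl i (by have t := aux11_mem_bl11 h12 hcl i; rw [h] at t; exact t)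
omit σ in
/-- `c ∉ L_i` -/
theorem c_not_mem_bl11 (i : Fin 13) : c ∉ bl11 h12 hcl i := fun h => by
  have e : bl11 h12 hcl i = cx11 h12 hcl i :=
    (Nondegenerate.eq_or_eq h (axPt11_mem_bl11 h12 hcl i) (c_mem_cx11 h12 hcl i) (axPt11_mem_cx11 h12 hcl i)).resolve_left
      (c_ne_axPt11 h12 hcl i)
  have t := aux11_mem_bl11 h12 hcl i
  rw [e] at t
  exact aux11_not_mem_cx11 h12 hcl i t
omit σ in
/-- `L_i ∩ l = {X_i}` -/
theorem eq_axPt11_of_mem_bl11_of_mem_axis (i : Fin 13) {p : P} (h1 : p ∈ bl11 h12 hcl i) (h2 : p ∈ l) : p = axPt11 h12 l i :=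
  (Nondegenerate.eq_or_eq h1 (axPt11_mem_bl11 h12 hcl i) h2 (axPt11_mem h12 i)).resolve_right (bl11_ne_axis h12 hcl i)
omit σ in
/-- `L_i ≠ c X_j` -/
theorem bl11_ne_cx11 (i j : Fin 13) : bl11 h12 hcl i ≠ cx11 h12 hcl j := fun h =>
  c_not_mem_bl11 h12 hcl i (by have t := c_mem_cx11 h12 hcl j; rw [← h] at t; exact t)

/-! ### The exponents `d i j` -/

include hne hq hl hc in
/-- **`L_i` meets `c X_j` (`j ≠ i`) in a point `σ^x P_j`**: `x ↦ σ^x P_j` (`x < 11`) is injective into the `11` points of `c X_j`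
other than `c, X_j`, hence onto. -/
theorem exists_pow_bp11_mem_bl11 {i j : Fin 13} (hji : j ≠ i) : ∃ x : ℕ, x < 11 ∧ (σ.onPoints ^ x) (bp11 h12 hcl j) ∈ bl11 h12 hcl i := by
  -- the target set
  let T := {p : P // p ∈ cx11 h12 hcl j ∧ p ≠ c ∧ p ≠ axPt11 h12 l j}
  have hT : Fintype.card T = 11 := by
    simp only [T]
    rw [Fintype.card_subtype]
    have h13 := card_points_on_line (P := P) (cx11 h12 hcl j)
    rw [h12] at h13
    have hset : (univ.filter fun p : P => p ∈ cx11 h12 hcl j ∧ p ≠ c ∧ p ≠ axPt11 h12 l j)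
        = ((univ.filter fun p : P => p ∈ cx11 h12 hcl j).erase c).erase (axPt11 h12 l j) := by
      ext p; simp only [mem_filter, mem_univ, true_and, mem_erase]; tauto
    have hm1 : c ∈ univ.filter fun p : P => p ∈ cx11 h12 hcl j := by simp [c_mem_cx11 h12 hcl j]
    have hm2 : axPt11 h12 l j ∈ (univ.filter fun p : P => p ∈ cx11 h12 hcl j).erase c := by
      rw [mem_erase]; exact ⟨(c_ne_axPt11 h12 hcl j).symm, by simp [axPt11_mem_cx11 h12 hcl j]⟩
    rw [hset, card_erase_of_mem hm2, card_erase_of_mem hm1, h13]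
  -- the map
  have hmem : ∀ x : ℕ, (σ.onPoints ^ x) (bp11 h12 hcl j) ∈ cx11 h12 hcl j := fun x =>
    σ.pow_apply_mem_of_fixed (σ.cx11_fixed h12 hc hcl j) (bp11_mem_cx11 h12 hcl j) x
  have hnc : ∀ x : ℕ, (σ.onPoints ^ x) (bp11 h12 hcl j) ≠ c := fun x h =>
    bp11_ne_c h12 hcl j ((σ.onPoints ^ x).injective
      (h.trans (Equiv.Perm.pow_apply_eq_self_of_apply_eq_self (σ.center_fixed hl hc) x).symm))
  have hnX : ∀ x : ℕ, (σ.onPoints ^ x) (bp11 h12 hcl j) ≠ axPt11 h12 l j := fun x h =>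
    bp11_ne_axPt11 h12 hcl j ((σ.onPoints ^ x).injective
      (h.trans (Equiv.Perm.pow_apply_eq_self_of_apply_eq_self (hl _ (axPt11_mem h12 j)) x).symm))
  let f : Fin 11 → T := fun x => ⟨(σ.onPoints ^ (x : ℕ)) (bp11 h12 hcl j), hmem x, hnc x, hnX x⟩
  have hf : Function.Injective f := by
    intro x y hxy
    have e : (σ.onPoints ^ (x : ℕ)) (bp11 h12 hcl j) = (σ.onPoints ^ (y : ℕ)) (bp11 h12 hcl j) := congrArg Subtype.val hxy
    by_contra hne'
    have key : ∀ a b : ℕ, a < b → b < 11 → (σ.onPoints ^ a) (bp11 h12 hcl j) = (σ.onPoints ^ b) (bp11 h12 hcl j) → False := by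
      intro a b hab hb hfix
      have e' : (σ.onPoints ^ a) (bp11 h12 hcl j) = (σ.onPoints ^ a) ((σ.onPoints ^ (b - a)) (bp11 h12 hcl j)) := by
        rw [← Equiv.Perm.mul_apply, ← pow_add, show a + (b - a) = b by omega]; exact hfix
      exact σ.pow_apply_ne_of_off_axis hne hq hl hc (k := b - a) (by omega) (bp11_not_mem_axis h12 hcl j) (bp11_ne_c h12 hcl j)
        ((σ.onPoints ^ a).injective e').symm
    rcases Nat.lt_or_gt_of_ne (fun h => hne' (Fin.ext h)) with hlt | hlt
    · exact key x y hlt y.isLt e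
    · exact key y x hlt x.isLt e.symm
  have hbij : Function.Bijective f :=
    (Fintype.bijective_iff_injective_and_card f).2 ⟨hf, by rw [Fintype.card_fin]; exact hT.symm⟩
  -- the meet of L_i and c X_j
  have hneL : bl11 h12 hcl i ≠ cx11 h12 hcl j := bl11_ne_cx11 h12 hcl i j
  set R : P := HasPoints.mkPoint hneL with hRdef
  have hR1 : R ∈ bl11 h12 hcl i := (HasPoints.mkPoint_ax hneL).1
  have hR2 : R ∈ cx11 h12 hcl j := (HasPoints.mkPoint_ax hneL).2
  have hRc : R ≠ c := fun e => c_not_mem_bl11 h12 hcl i (by rw [e] at hR1; exact hR1)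
  have hRX : R ≠ axPt11 h12 l j := fun e => by
    rw [e] at hR1
    exact hji (axPt11_injective h12 (eq_axPt11_of_mem_bl11_of_mem_axis h12 hcl i hR1 (axPt11_mem h12 j)))
  obtain ⟨x, hx⟩ := hbij.2 ⟨R, hR2, hRc, hRX⟩
  refine ⟨x, x.isLt, ?_⟩
  have e := congrArg Subtype.val hx
  simp only [f] at e
  rw [e]; exact hR1

/-- **`d i j`** as a natural exponent `< 11` (`0` on the diagonal). -/
noncomputable def dexp11 (i j : Fin 13) : ℕ :=
  if h : j ≠ i then Classical.choose (σ.exists_pow_bp11_mem_bl11 h12 hne hq hl hc hcl h) else 0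

/-- `σ^{d i j} P_j ∈ L_i` for `j ≠ i` -/
theorem pow_dexp11_mem {i j : Fin 13} (hji : j ≠ i) :
    (σ.onPoints ^ σ.dexp11 h12 hne hq hl hc hcl i j) (bp11 h12 hcl j) ∈ bl11 h12 hcl i := by
  rw [dexp11, dif_pos hji]
  exact (Classical.choose_spec (σ.exists_pow_bp11_mem_bl11 h12 hne hq hl hc hcl hji)).2

/-- **The Case-A array of the plane**: `d i j ∈ ZMod 11`. -/
noncomputable def homArray11 (i j : Fin 13) : ZMod 11 := (σ.dexp11 h12 hne hq hl hc hcl i j : ZMod 11)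

/-! ### The row condition -/

include hl in
/-- `X_i ∈ σ^k L_i` -/
theorem axPt11_mem_pow_bl11 (i : Fin 13) (k : ℕ) : axPt11 h12 l i ∈ (σ.onLines ^ k) (bl11 h12 hcl i) := by
  have h := (σ.pow_mem_iff k (axPt11 h12 l i) (bl11 h12 hcl i)).2 (axPt11_mem_bl11 h12 hcl i)
  rwa [Equiv.Perm.pow_apply_eq_self_of_apply_eq_self (hl _ (axPt11_mem h12 i)) k] at h

include hl in
/-- `σ^k L_i ≠ l` -/
theorem pow_bl11_ne_axis (i : Fin 13) (k : ℕ) : (σ.onLines ^ k) (bl11 h12 hcl i) ≠ l := by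
  intro h
  apply bl11_ne_axis h12 hcl i
  apply (σ.onLines ^ k).injective
  rw [h, Equiv.Perm.pow_apply_eq_self_of_apply_eq_self (σ.axis_fixed hl) k]

include hl in
/-- `σ^a L_i ≠ σ^b L_{i'}` for `i ≠ i'` (they meet `l` in `X_i ≠ X_{i'}`) -/
theorem pow_bl11_ne_pow_bl11 {i i' : Fin 13} (hii' : i ≠ i') (a b : ℕ) :
    (σ.onLines ^ a) (bl11 h12 hcl i) ≠ (σ.onLines ^ b) (bl11 h12 hcl i') := by
  intro h
  have h1 := σ.axPt11_mem_pow_bl11 h12 hl hcl i a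
  have h2 := σ.axPt11_mem_pow_bl11 h12 hl hcl i' b
  rw [← h] at h2
  have hX : axPt11 h12 l i ≠ axPt11 h12 l i' := fun e => hii' (axPt11_injective h12 e)
  exact σ.pow_bl11_ne_axis h12 hl hcl i a ((Nondegenerate.eq_or_eq h1 h2 (axPt11_mem h12 i) (axPt11_mem h12 i')).resolve_left hX)

include hc in
/-- `σ^k P_j ∈ c X_j` -/
theorem pow_bp11_mem_cx11 (j : Fin 13) (k : ℕ) : (σ.onPoints ^ k) (bp11 h12 hcl j) ∈ cx11 h12 hcl j :=
  σ.pow_apply_mem_of_fixed (σ.cx11_fixed h12 hc hcl j) (bp11_mem_cx11 h12 hcl j) k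

include hl hc in
/-- `σ^k P_j ≠ c` -/
theorem pow_bp11_ne_c (j : Fin 13) (k : ℕ) : (σ.onPoints ^ k) (bp11 h12 hcl j) ≠ c := fun h =>
  bp11_ne_c h12 hcl j ((σ.onPoints ^ k).injective
    (h.trans (Equiv.Perm.pow_apply_eq_self_of_apply_eq_self (σ.center_fixed hl hc) k).symm))

omit [ProjectivePlane P L] [Fintype P] [Fintype L] in
include hq in
/-- from `σ^a p ∈ m`: `σ^(b + a) p ∈ σ^b m`, with the exponent reduced mod 11 -/
theorem pow_add_apply_mem {a b e : ℕ} {p : P} {m : L} (h : (σ.onPoints ^ a) p ∈ m) (he : e % 11 = (b + a) % 11) :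
    (σ.onPoints ^ e) p ∈ (σ.onLines ^ b) m := by
  rw [pow_apply_eq_pow_mod σ.onPoints hq, he, ← pow_apply_eq_pow_mod σ.onPoints hq, pow_add, Equiv.Perm.mul_apply]
  exact (σ.pow_mem_iff b _ m).2 h

/-- **The Case-A array of the plane satisfies the row condition `QdmRows 11 13`.** -/
theorem qdmRows_homArray11 : QdmRows 11 13 (σ.homArray11 h12 hne hq hl hc hcl) := by
  intro i i' hii' j j' hjj' hji hji' hj'i hj'i' heq
  simp only [homArray11] at heq
  -- name the four exponents
  set a := σ.dexp11 h12 hne hq hl hc hcl i j with ha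
  set b := σ.dexp11 h12 hne hq hl hc hcl i' j with hb
  set a' := σ.dexp11 h12 hne hq hl hc hcl i j' with ha'
  set b' := σ.dexp11 h12 hne hq hl hc hcl i' j' with hb'
  have hmod : (a + b') % 11 = (a' + b) % 11 := by
    rw [sub_eq_sub_iff_add_eq_add] at heq
    rw [← ZMod.natCast_eq_natCast_iff', Nat.cast_add, Nat.cast_add]
    exact heq
  -- the two points
  have hA : (σ.onPoints ^ a) (bp11 h12 hcl j) ∈ bl11 h12 hcl i := σ.pow_dexp11_mem h12 hne hq hl hc hcl hji
  have hB : (σ.onPoints ^ b) (bp11 h12 hcl j) ∈ bl11 h12 hcl i' := σ.pow_dexp11_mem h12 hne hq hl hc hcl hji'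
  have hA' : (σ.onPoints ^ a') (bp11 h12 hcl j') ∈ bl11 h12 hcl i := σ.pow_dexp11_mem h12 hne hq hl hc hcl hj'i
  have hB' : (σ.onPoints ^ b') (bp11 h12 hcl j') ∈ bl11 h12 hcl i' := σ.pow_dexp11_mem h12 hne hq hl hc hcl hj'i'
  have h1 : (σ.onPoints ^ (a + b')) (bp11 h12 hcl j) ∈ (σ.onLines ^ b') (bl11 h12 hcl i) :=
    σ.pow_add_apply_mem hq hA (by omega)
  have h2 : (σ.onPoints ^ (a + b')) (bp11 h12 hcl j) ∈ (σ.onLines ^ a') (bl11 h12 hcl i') :=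
    σ.pow_add_apply_mem hq hB (by omega)
  have h3 : (σ.onPoints ^ (a' + b')) (bp11 h12 hcl j') ∈ (σ.onLines ^ b') (bl11 h12 hcl i) :=
    σ.pow_add_apply_mem hq hA' (by omega)
  have h4 : (σ.onPoints ^ (a' + b')) (bp11 h12 hcl j') ∈ (σ.onLines ^ a') (bl11 h12 hcl i') :=
    σ.pow_add_apply_mem hq hB' (by omega)
  -- the two lines are distinct, so the points coincide
  have hlines := σ.pow_bl11_ne_pow_bl11 h12 hl hcl hii' b' a'
  have hpts : (σ.onPoints ^ (a + b')) (bp11 h12 hcl j) = (σ.onPoints ^ (a' + b')) (bp11 h12 hcl j') :=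
    (Nondegenerate.eq_or_eq h1 h3 h2 h4).resolve_right hlines
  -- but they lie on the distinct fixed lines c X_j, c X_j', so both are c
  have hc1 := σ.pow_bp11_mem_cx11 h12 hc hcl j (a + b')
  have hc2 := σ.pow_bp11_mem_cx11 h12 hc hcl j' (a' + b')
  rw [← hpts] at hc2
  exact σ.pow_bp11_ne_c h12 hl hc hcl j (a + b') (eq_c_of_mem_cx11_of_mem_cx11 h12 hcl hjj' hc1 hc2)

end ElevenA

/-- **Case A is dead under `NoHomologyArray12`:** a projective plane of order 12 with a collineation `σ ≠ 1`, `σ¹¹ = 1`, has no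
axis `l` and centre `c ∉ l`. -/
theorem no_homology11_of_noHomologyArray12 (hA : NoHomologyArray12) (h12 : ProjectivePlane.order P L = 12) (hne : σ.onPoints ≠ 1)
    (hq : σ.onPoints ^ 11 = 1) : ¬ ∃ (l : L) (c : P), σ.IsAxis l ∧ σ.IsCenter c ∧ c ∉ l := by
  rintro ⟨l, c, hl, hc, hcl⟩
  exact hA _ (σ.qdmRows_homArray11 h12 hne hq hl hc hcl)

end Collineation

end Summit.Ventures.DiscreteObjects.PP12
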